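import Literature.AlgebraicGeometry.Resolution.InseparableLocalUniformizationHeightZero
import Literature.AlgebraicGeometry.Resolution.InseparableLocalUniformizationDescent
import Literature.AlgebraicGeometry.Resolution.NormalizationOfVarietiesProofs
import HarnessLib

/-!
# Inseparable local uniformization (Temkin 2013, Thm. 1.3.2): discharged inputs and the frontier

Topic: `Literature/AlgebraicGeometry/Resolution`. Roof of the files vendoring M. Temkin's
*Inseparable local uniformization* (all numbers and pages: journal version = arXiv:0804.1554v3):

* `LocalUniformization.lean` — the named fact `Temkin2013` (Thm. 1.3.2, weak absolute form) used
  by the routes, and the original relative rendering `Temkin2013Rel`;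
* `InseparableLocalUniformization.lean` — `Temkin2013Rel` is REFUTED (`not_temkin2013Rel`: it
  renders "simple" as algebraic separability of `k(𝔭)/l`); the corrected relative form
  `Temkin2013Relative` (⇒ `Temkin2013`), its height filtration `Temkin2013RelHeightLE n`,
  finiteness of the height (`ringKrullDim_valuationSubring_le_trdeg`, PROVED) and the assembly
  `Temkin2013Relative.of_height` from the named facts `Temkin2013HeightLeOne` (§4.1) and
  `Temkin2013HeightStep` (§4.2);
* `InseparableLocalUniformizationDescent.lean` — one printed layer lower: the named facts
  `Temkin2013Descent` (Thm. 4.1.1 with `n = 1`, the descent form) and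
  `Temkin2013HeightStepOfDescent` (§4.2 with its printed inputs), and the PROVED reductions
  `Temkin2013Descent.heightLeOne`, `Temkin2013Relative.of_descent`, both modulo E. Noether's
  finiteness of the integral closure `NoetherFiniteIntegralClosure` (Liu 2002, Prop. 4.1.27);
* `SeparatingTranscendenceBasis.lean`, `InseparableLocalUniformizationHeightZero.lean` — the
  height-`0` case `Temkin2013RelHeightLE.zero` PROVED (proof of Thm. 4.1.1, first sentence,
  p. 47: "the case of valued fields of height zero reduces to the classical theorem on the
  existence of a separating transcendence basis"), again modulo `NoetherFiniteIntegralClosure`;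
* `NormalizationOfVarietiesProofs.lean` — `NoetherFiniteIntegralClosure_holds`, E. Noether's
  finiteness theorem PROVED in full (inseparable case included).

This file feeds the last item into the previous ones, so that every ELEMENTARY input of
Temkin's §4 is discharged and the two remaining hypotheses of Thm. 1.3.2 are results of the
paper under their own numbers:

* `Temkin2013RelHeightLE.zero_holds : Temkin2013RelHeightLE 0` — Thm. 1.3.2 (corrected relative
  form) for the trivial valuation, PROVED unconditionally.
* `exists_normal_affineModel_ge'` — the normalisation `Nr_K(X)` of an affine model of `K°` is a
  normal affine model of `K°` refining it (Step 0 of the proof of Thm. 4.1.1, p. 47), PROVED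
  unconditionally.
* `Temkin2013HeightLeOne.of_descent : Temkin2013Descent → Temkin2013HeightLeOne` — §4.1 from
  Thm. 4.1.1 (`n = 1`, `K₁ = K`, applied to `Nr_K(X)`), PROVED unconditionally.
* `Temkin2013Relative.of_frontier`, `Temkin2013.of_frontier` — PROVED:
  `Temkin2013Descent → Temkin2013HeightStepOfDescent → Temkin2013Relative` (resp. `Temkin2013`).
  **Frontier of `Temkin2013`** = {`Temkin2013Descent` = Thm. 4.1.1 (`n = 1`),
  `Temkin2013HeightStepOfDescent` = §4.2}. Below Thm. 4.1.1 the printed proof (pp. 47–50: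
  induction on the transcendence defect; Thm. 5.5.2 for Abhyankar valuations via log
  smoothness; Thm. 3.3.1 via decompletion of the Berkovich-analytic Thm. 3.2.6 and the stable
  modification theorem; Lemmas 2.8.4/2.8.5, Prop. 2.3.8) needs notions Mathlib lacks (extensions
  of valued fields and their transcendence defect, η-normalised schemes of normalized finite
  presentation over valuation rings, smooth-equivalence of points, Berkovich curves, log smooth
  points of simplicial shape); §4.2 needs composite valuations on such models and Lemma 3.3.2.
* `temkin2013Relative_iff_frontier` — modulo `Temkin2013Descent`, the corrected Thm. 1.3.2 is
  EQUIVALENT to the §4.2 step with its printed inputs; `Temkin2013HeightStep.of_frontier` — the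
  new frontier implies the original one `{Temkin2013HeightLeOne, Temkin2013HeightStep}` of
  `InseparableLocalUniformization.lean`.

## Sources

* M. Temkin, *Inseparable local uniformization*, J. Algebra 373 (2013) 65–119 =
  arXiv:0804.1554v3: Thm. 1.3.2 and the conventions after it (pp. 3–4), §4 (p. 46), Thm. 4.1.1,
  Remark 4.1.2 and Step 0 of its proof (p. 47), §4.2 (pp. 50–51).
* Q. Liu, *Algebraic Geometry and Arithmetic Curves*, OUP (2002), Prop. 4.1.27 (E. Noether's
  finiteness of the integral closure) — `NoetherFiniteIntegralClosure`, proved in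
  `NormalizationOfVarietiesProofs.lean`.
-/

noncomputable section

namespace Literature.AlgebraicGeometry.Resolution

universe u

/-! ### Height zero, unconditionally -/

/-- **Temkin's Thm. 1.3.2 in height `0`** (corrected relative form, trivial valuation ring
`K° = K`), PROVED unconditionally: `Temkin2013RelHeightLE.zero`
(`InseparableLocalUniformizationHeightZero.lean`) fed with E. Noether's finiteness of the
integral closure `NoetherFiniteIntegralClosure_holds` (`NormalizationOfVarietiesProofs.lean`).
The base of the induction on the height; it also certifies that the corrected conclusion
`Temkin2013RelConclusion` is satisfiable exactly where `Temkin2013Rel` was refuted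
(`not_temkin2013Rel`: `K = k(t)`, `K° = K`).
[cite: Temkin2013, Thm. 1.3.2 in height 0 = proof of Thm. 4.1.1, first sentence (arXiv:0804.1554v3 p. 47)] -/
theorem Temkin2013RelHeightLE.zero_holds : Temkin2013RelHeightLE.{u} 0 :=
  Temkin2013RelHeightLE.zero NoetherFiniteIntegralClosure_holds.{u}

/-! ### Normalisation of affine models, unconditionally -/

section normalisation

variable {k K : Type u} [Field k] [Field K] [Algebra k K]

/-- **The normalisation `Nr_K(X)` of an affine model `X = Spec A` of a valuation ring `K° ⊇ k`
is a normal affine model of `K°` refining `X`**, unconditionally: there is a finitely generated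
`k`-subalgebra `B` with `A ≤ B ⊆ K°`, `Frac B = K`, `B` integrally closed in `K`, whose
underlying set is the integral closure of `A` in `K` (`exists_normal_affineModel_ge` of
`InseparableLocalUniformizationDescent.lean` fed with `NoetherFiniteIntegralClosure_holds`;
Temkin 2013, p. 4: "`Nr_L(Spec A)` is the scheme `Spec(Nr_L(A))`", and proof of Thm. 4.1.1,
Step 0, p. 47: one may pass to finer affine models). [folklore] -/
theorem exists_normal_affineModel_ge' (O : ValuationSubring K) (A : Subalgebra k K)
    (hAO : A.toSubring ≤ O.toSubring) (hAfg : A.FG) (hAfr : IsFractionRing A K) :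
    ∃ B : Subalgebra k K, A ≤ B ∧ B.toSubring ≤ O.toSubring ∧ B.FG ∧ IsFractionRing B K ∧
      (∀ x : K, IsIntegral B x → x ∈ B) ∧ (B : Set K) = {x : K | IsIntegral A x} :=
  exists_normal_affineModel_ge NoetherFiniteIntegralClosure_holds.{u} O A hAO hAfg hAfr

end normalisation

/-! ### The frontier of Thm. 1.3.2: Thm. 4.1.1 (`n = 1`) and §4.2 -/

/-- **§4.1 from the descent theorem, unconditionally**: Thm. 4.1.1 with `n = 1`, `K₁ = K`
applied to the normal affine model `Nr_K(X)` gives the corrected relative Thm. 1.3.2 for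
valuation rings of height `≤ 1` (Temkin 2013, p. 46: "We will establish the height one case of
the Theorem in §4.1"; Remark 4.1.2, p. 47). This is `Temkin2013Descent.heightLeOne` with its
Noether-finiteness hypothesis discharged by `NoetherFiniteIntegralClosure_holds`.
[cite: Temkin2013, Section 4.1 (Thm. 4.1.1 with n = 1, Remark 4.1.2; arXiv:0804.1554v3 pp. 46–47)] -/
theorem Temkin2013HeightLeOne.of_descent (hD : Temkin2013Descent.{u}) :
    Temkin2013HeightLeOne.{u} :=
  hD.heightLeOne NoetherFiniteIntegralClosure_holds

/-- **Assembly of Temkin's §4 with every elementary input discharged.** The corrected relative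
Thm. 1.3.2 follows from the descent theorem in height `≤ 1` (Thm. 4.1.1, `n = 1`) and the
induction step on the height with its printed inputs (§4.2); finiteness of the height
(`ringKrullDim_valuationSubring_le_trdeg`), the height-`0` case and E. Noether's finiteness of
the integral closure are theorems of the tree. [cite: Temkin2013, Section 4 (arXiv:0804.1554v3 pp. 46–51)] -/
theorem Temkin2013Relative.of_frontier (hD : Temkin2013Descent.{u})
    (hs : Temkin2013HeightStepOfDescent.{u}) : Temkin2013Relative.{u} :=
  Temkin2013Relative.of_descent hD NoetherFiniteIntegralClosure_holds hs

/-- … hence the named fact `Temkin2013` (Thm. 1.3.2, weak absolute form used by the routes) from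
the two remaining results of the paper: `Temkin2013Descent` (Thm. 4.1.1, `n = 1`) and
`Temkin2013HeightStepOfDescent` (§4.2). [cite: Temkin2013, Thm. 1.3.2] -/
theorem Temkin2013.of_frontier (hD : Temkin2013Descent.{u})
    (hs : Temkin2013HeightStepOfDescent.{u}) : Temkin2013.{u} :=
  (Temkin2013Relative.of_frontier hD hs).temkin2013

/-- Modulo the descent theorem (Thm. 4.1.1, `n = 1`), the corrected relative Thm. 1.3.2 is
EQUIVALENT to the induction step on the height with its printed inputs (§4.2). [folklore] -/
theorem temkin2013Relative_iff_frontier (hD : Temkin2013Descent.{u}) :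
    Temkin2013Relative.{u} ↔ Temkin2013HeightStepOfDescent.{u} :=
  temkin2013Relative_iff_heightStepOfDescent hD NoetherFiniteIntegralClosure_holds

/-- In particular the original frontier `{Temkin2013HeightLeOne, Temkin2013HeightStep}` of
`InseparableLocalUniformization.lean` is implied by the new one. [folklore] -/
theorem Temkin2013HeightStep.of_frontier (hD : Temkin2013Descent.{u})
    (hs : Temkin2013HeightStepOfDescent.{u}) : Temkin2013HeightStep.{u} :=
  fun n _ _ => (Temkin2013Relative.of_frontier hD hs).heightLE (n + 1)

end Literature.AlgebraicGeometry.Resolution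

end
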